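import Summits.RiemannHypothesis.RiemannHypothesis.Theorems.TiltedLandingLaw421R3MenuThin
import Summits.RiemannHypothesis.RiemannHypothesis.Theorems.TiltedLandingLaw421R3LimitMenu

/-!
# TiltedLandingLaw421R3 — «MenuThinQR» (W-09 C4 scratch, rh-idea-6 g45): the datum kernel of #1308 in C3's scale-free variables `(Q, r)`

Dictionary (C3 RESULT-8 / (CA1163)(3)): datum `v = iY`, `w = δ + i t`, `m = Y − t > 0`, `r = (Y + t)/(Y − t)`, `Q = δ²/(Y² − t²)`, so
`Y = m(r+1)/2`, `t = m(r−1)/2`, `δ² = Q r m²`, `W = r² + 1 + 2Qr`.  PROVED (pure algebra over the tree defs `RhW08.MenuThin.kerRe/kerIm/kerNorm`):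
`Im K = (r − 1)(1 − Q)/(m(1 + Qr)(Q + r))`, `Re K = δ·W/(m² r (1 + Qr)(Q + r))`, and
`‖K‖² · (r m² (1 + Qr)²(Q + r)²) = Q W² + r (r − 1)²(1 − Q)²` — the first two terms of C3's `A(Q,r)/κ`; so `κ‖K‖²·D = A(Q,r) + 2Q(1 − Q)rW`
with the TREE's `RhW08.LimitMenu.limA/limW/kap` (#1314 «LimitMenu»).  v2 (§2): C3 RESULT-5's leading-order A-sector demand is
`Φ⁰ := (δ/t)·Re K·Im K` (σ_A → (δ/t)·Re K/‖K‖ against the available σ = κ‖K‖/Im K); PROVED `phi0_QR : Φ⁰ = 2Q(1 − Q)W/(m²(1 + Qr)²(Q + r)²)` and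
★★`asector_leading_iff : Φ⁰ ≤ κ‖K‖² ↔ 0 ≤ limA Q r` — C3's «(A0) ⟺ κ|K|² ≥ Φ⁰, exact identity, h-free, s-free» kernel-checked BY NAME against #1308 and #1314.
Material for the E5 link (leading order only: the boundary remainder is not here); no law, nothing asserted; sorry-free.
-/

noncomputable section

namespace RhW08.MenuThinQR

open RhW08.SinkBdry RhW08.MenuThin

/-- `A₁ = δ² + (t − Y)² = m²(1 + Qr)` in the `(Q, r, m)` chart. -/
theorem denom_near (Q r m δ : ℝ) (hδ : δ ^ 2 = Q * r * m ^ 2) :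
    (δ - 0) ^ 2 + (m * (r - 1) / 2 - m * (r + 1) / 2) ^ 2 = m ^ 2 * (1 + Q * r) := by
  rw [sub_zero, hδ]; ring

/-- `A₂ = δ² + (t + Y)² = r m²(Q + r)` in the `(Q, r, m)` chart. -/
theorem denom_far (Q r m δ : ℝ) (hδ : δ ^ 2 = Q * r * m ^ 2) :
    (δ - 0) ^ 2 + (m * (r - 1) / 2 + m * (r + 1) / 2) ^ 2 = m ^ 2 * r * (Q + r) := by
  rw [sub_zero, hδ]; ring

/-- `Im K_v(w) = (r − 1)(1 − Q)/(m (1 + Qr)(Q + r))`. -/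
theorem kerIm_QR (Q r m δ : ℝ) (hm : 0 < m) (hr : 0 < r) (hQ : 0 ≤ Q) (hδ : δ ^ 2 = Q * r * m ^ 2) :
    kerIm δ (m * (r - 1) / 2) (m * (r + 1) / 2) = (r - 1) * (1 - Q) / (m * (1 + Q * r) * (Q + r)) := by
  unfold kerIm pairCForm
  rw [denom_near Q r m δ hδ, denom_far Q r m δ hδ]
  have h1 : 0 < 1 + Q * r := by positivity
  have h2 : 0 < Q + r := by positivity
  field_simp
  ring

/-- `Re K_v(w) = δ · W/(m² r (1 + Qr)(Q + r))`, `W = r² + 1 + 2Qr`. -/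
theorem kerRe_QR (Q r m δ : ℝ) (hm : 0 < m) (hr : 0 < r) (hQ : 0 ≤ Q) (hδ : δ ^ 2 = Q * r * m ^ 2) :
    kerRe δ (m * (r - 1) / 2) (m * (r + 1) / 2) = δ * ((r ^ 2 + 1 + 2 * Q * r) / (m ^ 2 * r * (1 + Q * r) * (Q + r))) := by
  unfold kerRe pairReForm
  rw [denom_near Q r m δ hδ, denom_far Q r m δ hδ]
  have h1 : 0 < 1 + Q * r := by positivity
  have h2 : 0 < Q + r := by positivity
  field_simp
  ring

/-- `‖K‖² = Re K² + Im K²` for the closed forms. -/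
theorem kerNorm_sq (δ t Y : ℝ) : kerNorm δ t Y ^ 2 = kerRe δ t Y ^ 2 + kerIm δ t Y ^ 2 := by
  unfold kerNorm; rw [Real.sq_sqrt (by positivity)]

/-- ★ `‖K_v(w)‖² · (r m² (1 + Qr)²(Q + r)²) = Q W² + r (r − 1)²(1 − Q)²` — the kernel part of C3 RESULT-8's `A(Q,r)`. -/
theorem kerNorm_sq_QR (Q r m δ : ℝ) (hm : 0 < m) (hr : 0 < r) (hQ : 0 ≤ Q) (hδ : δ ^ 2 = Q * r * m ^ 2) :
    kerNorm δ (m * (r - 1) / 2) (m * (r + 1) / 2) ^ 2 * (r * m ^ 2 * (1 + Q * r) ^ 2 * (Q + r) ^ 2) =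
      Q * (r ^ 2 + 1 + 2 * Q * r) ^ 2 + r * (r - 1) ^ 2 * (1 - Q) ^ 2 := by
  rw [kerNorm_sq, kerRe_QR Q r m δ hm hr hQ hδ, kerIm_QR Q r m δ hm hr hQ hδ, mul_pow, hδ]
  have h1 : 0 < 1 + Q * r := by positivity
  have h2 : 0 < Q + r := by positivity
  field_simp

/-- the chart is onto the strictly nested data: for `0 < t < Y`, `δ² + t² < Y²` one has `m = Y − t > 0`, `r = (Y+t)/(Y−t) > 1`, `0 ≤ Q < 1`
and the three defining relations. -/
theorem chart_of_datum {δ t Y : ℝ} (ht : 0 < t) (htY : t < Y) (hnest : δ ^ 2 + t ^ 2 < Y ^ 2) :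
    0 < Y - t ∧ 1 < (Y + t) / (Y - t) ∧ 0 ≤ δ ^ 2 / (Y ^ 2 - t ^ 2) ∧ δ ^ 2 / (Y ^ 2 - t ^ 2) < 1 ∧
    t = (Y - t) * ((Y + t) / (Y - t) - 1) / 2 ∧ Y = (Y - t) * ((Y + t) / (Y - t) + 1) / 2 ∧
    δ ^ 2 = δ ^ 2 / (Y ^ 2 - t ^ 2) * ((Y + t) / (Y - t)) * (Y - t) ^ 2 := by
  have hm : 0 < Y - t := by linarith
  have hp : 0 < Y + t := by linarith
  have hYt : 0 < Y ^ 2 - t ^ 2 := by nlinarith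
  refine ⟨hm, ?_, by positivity, ?_, ?_, ?_, ?_⟩
  · rw [lt_div_iff₀ hm]; linarith
  · rw [div_lt_one hYt]; linarith
  · field_simp; ring
  · field_simp; ring
  · field_simp; ring

/-! ## §2 The leading-order A-sector identity of C3 RESULT-5/8, by name against the tree's `RhW08.LimitMenu` (#1314) -/

/-- `Φ⁰ = (δ/t)·Re K·Im K = 2Q(1 − Q)·W/(m²(1 + Qr)²(Q + r)²)` in the chart (`t = m(r − 1)/2`, `r > 1`), `W = RhW08.LimitMenu.limW Q r`. -/
theorem phi0_QR (Q r m δ : ℝ) (hm : 0 < m) (hr : 1 < r) (hQ : 0 ≤ Q) (hδ : δ ^ 2 = Q * r * m ^ 2) :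
    δ / (m * (r - 1) / 2) * kerRe δ (m * (r - 1) / 2) (m * (r + 1) / 2) * kerIm δ (m * (r - 1) / 2) (m * (r + 1) / 2) =
      2 * Q * (1 - Q) * RhW08.LimitMenu.limW Q r / (m ^ 2 * (1 + Q * r) ^ 2 * (Q + r) ^ 2) := by
  have hr0 : 0 < r := by linarith
  rw [kerRe_QR Q r m δ hm hr0 hQ hδ, kerIm_QR Q r m δ hm hr0 hQ hδ]
  have h1 : 0 < 1 + Q * r := by positivity
  have h2 : 0 < Q + r := by positivity
  have hr1 : 0 < r - 1 := by linarith
  have hre : δ / (m * (r - 1) / 2) * (δ * ((r ^ 2 + 1 + 2 * Q * r) / (m ^ 2 * r * (1 + Q * r) * (Q + r)))) *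
      ((r - 1) * (1 - Q) / (m * (1 + Q * r) * (Q + r))) =
      δ ^ 2 * ((r ^ 2 + 1 + 2 * Q * r) / (m ^ 2 * r * (1 + Q * r) * (Q + r)) * ((r - 1) * (1 - Q) / (m * (1 + Q * r) * (Q + r))) /
        (m * (r - 1) / 2)) := by ring
  rw [hre, hδ]
  unfold RhW08.LimitMenu.limW
  field_simp

/-- ★★ THE LEADING-ORDER A-SECTOR IDENTITY (C3 RESULT-5/8 «(A0) ⟺ κ|K|² ≥ Φ⁰»): in the chart, `(δ/t)·Re K·Im K ≤ κ·‖K‖² ↔ 0 ≤ limA Q r`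
(`κ = RhW08.LimitMenu.kap = 27/256`; both sides are the datum-only leading order — no boundary remainder here). -/
theorem asector_leading_iff (Q r m δ : ℝ) (hm : 0 < m) (hr : 1 < r) (hQ : 0 ≤ Q) (hδ : δ ^ 2 = Q * r * m ^ 2) :
    δ / (m * (r - 1) / 2) * kerRe δ (m * (r - 1) / 2) (m * (r + 1) / 2) * kerIm δ (m * (r - 1) / 2) (m * (r + 1) / 2) ≤
        RhW08.LimitMenu.kap * kerNorm δ (m * (r - 1) / 2) (m * (r + 1) / 2) ^ 2 ↔
      0 ≤ RhW08.LimitMenu.limA Q r := by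
  have hr0 : 0 < r := by linarith
  have h1 : 0 < 1 + Q * r := by positivity
  have h2 : 0 < Q + r := by positivity
  have hD : 0 < r * m ^ 2 * (1 + Q * r) ^ 2 * (Q + r) ^ 2 := by positivity
  have hN : kerNorm δ (m * (r - 1) / 2) (m * (r + 1) / 2) ^ 2 =
      (Q * (r ^ 2 + 1 + 2 * Q * r) ^ 2 + r * (r - 1) ^ 2 * (1 - Q) ^ 2) / (r * m ^ 2 * (1 + Q * r) ^ 2 * (Q + r) ^ 2) := by
    rw [eq_div_iff hD.ne']; exact kerNorm_sq_QR Q r m δ hm hr0 hQ hδ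
  have key : RhW08.LimitMenu.kap * kerNorm δ (m * (r - 1) / 2) (m * (r + 1) / 2) ^ 2 -
      δ / (m * (r - 1) / 2) * kerRe δ (m * (r - 1) / 2) (m * (r + 1) / 2) * kerIm δ (m * (r - 1) / 2) (m * (r + 1) / 2) =
      RhW08.LimitMenu.limA Q r / (r * m ^ 2 * (1 + Q * r) ^ 2 * (Q + r) ^ 2) := by
    rw [phi0_QR Q r m δ hm hr hQ hδ, hN]
    unfold RhW08.LimitMenu.limA RhW08.LimitMenu.limW RhW08.LimitMenu.kap
    field_simp
  rw [← sub_nonneg, key]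
  constructor
  · intro h
    by_contra hA
    have hlt : RhW08.LimitMenu.limA Q r / (r * m ^ 2 * (1 + Q * r) ^ 2 * (Q + r) ^ 2) < 0 := div_neg_of_neg_of_pos (not_le.mp hA) hD
    linarith
  · intro h
    exact div_nonneg h hD.le

end RhW08.MenuThinQR

end
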